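import Summits.BirchSwinnertonDyer.BirchSwinnertonDyer.Theorems.ErratumRoadFiveOpenInputRamResidual
import Summits.BirchSwinnertonDyer.BirchSwinnertonDyer.Theorems.ErratumRoadFiveOpenInputIMCSplitGlue
import HarnessLib

/-!
# Route `ErratumRoadFive`, crux `OpenInputIMC` (item stmt-BirchSwinnertonDyer-19061): the crux from
# its erratum-road halves at every pair, the published facts, the ¬(ram) child and the two honest
# (ram) atoms (α) "no odd non-split `E[p]`-ramified multiplicative witness", (β) "`E(ℚ_p)[p] ≠ 0`"
# (file 5 of seat imc-p1; session g3)

Cell `bsd-stepL` (run/shared/lean/pub/bsd-stepL/), seat `bsd-stepL-imc-p1` (prover; D-0074 row A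
«Cas24 → FW21 4.41 → `P2OpenInputOnTreeAt` reduction ⇒ 19061 shrinks to ¬(ram)»), session g3;
`--supports stmt-BirchSwinnertonDyer-19061`. HONEST FRAMING: nothing here proves the crux; BSD is not
proved by any of this; the children `IMCDivAtErratumDataAll` (19270: H3♭ at every pair ⇐ Castella's
erratum Thm. 1.1 ⇐ [FW21, Thm. 4.41], PREPRINT), `BDPValueCoreFramesAll` (19275: H2 at every pair,
cell memo THEOREM C♯; print on semistable pairs) and `OpenInputNotRam` (19282: no road) are OPEN
route items taken as HYPOTHESES, and every published ∕ cited named fact is a hypothesis. THEOREMS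
ONLY; pure composition of file 4 (`ErratumRoadFiveOpenInputRamResidual`, p433634: child 19274 ⟸
siblings + REST‴) with the landed five-child glue `openInputIMCOfChildren_holds` (item 19284, CLOSED).

## What this file proves

* `openInputIMC_of_children_of_rest3_of_notRam` — `IMCDivAtErratumDataAll` (19270) →
  `BDPValueCoreFramesAll` (19275) → `PublishedInputsIMCReduction` (19283) →
  `WuthrichShaDividesAnalyticSha` (19285; Wuthrich 2014 Prop. 21, PUBLISHED) →
  `thm331_anticyclotomicControl_mult` (Jetchev–Skinner–Wan 2017 Thm. 3.3.1 + (3.5.c), PUBLISHED,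
  p428223) → REST‴ → `OpenInputNotRam` (19282) → `OpenInputIMC`.
* `openInputIMC_of_children_of_atoms_of_notRam` — the same with REST‴ replaced by its two atoms
  (α), (β) (file 4's `rest3_of_noOddWitness_of_localTorsionNeZero`).
* `openInputIMC_of_erratumThm11_OPEN_of_bdpValueCoreFrames_of_atoms_of_notRam` — the same with H3♭
  supplied BY CITATION from the typed OPEN fact (erratum Thm. 1.1 = arXiv:2409.01360 Thm. 3.1,
  `_OPEN`, p417695; bridge `imcDivAtErratumDataAll_of_erratumThm11_OPEN`).

READING (the seat's row, kernel form): modulo H3♭ (PREPRINT) and H2 at every pair and published facts,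
the deciding crux of route K2 SHRINKS to the ¬(ram) child (cw 112 239) plus the (ram) atoms (α)
(700 633: every ramified witness split 548 970, only `q = 2` non-split 151 663) and (β) (2 571 with
an odd witness) — cw 703 204 of the (ram) atom's 2 155 109 (census fold of multr1-p1
`census2_all_500k.tsv.gz`, `p ≥ 5`, `N < 5·10⁵`) — which the erratum's hypotheses (iii) [non-split at
the ramified prime; odd `d_K` from Cas20's standing hypotheses] and (iv) exclude BY DESIGN: no
semistability, no Locus, no second ramified prime remain. CONDITIONAL; nothing booked; closes rung K2
of BirchSwinnertonDyer for NO pair by itself.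

References: [Castella2018Erratum] Thm. 1.1 (i)–(iv), (2.4) (pp. 1, 4); [Castella2024] Thm. 3.1;
[FouquetWan2021] Thm. 4.41; [JetchevSkinnerWan2017] Thm. 3.3.1, §3.5 (3.5.c); [Wuthrich2014]
Prop. 21; [Castella2018] Thms. 3.1–3.2, §5 (arXiv:1704.06608); [Miller2011LMS] Def. 1.1.
-/

set_option autoImplicit false
set_option linter.dupNamespace false

noncomputable section

open scoped Classical

open WeierstrassCurve NumberField IsDedekindDomain Field
open Literature.NumberTheory.EllipticCurves
open Literature.NumberTheory.EllipticCurves.Rank1Residual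
open Literature.NumberTheory.EllipticCurves.Castella2018
open Literature.NumberTheory.EllipticCurves.JetchevSkinnerWan2017
open Summit.BirchSwinnertonDyer.Rank1Residual Summit.BirchSwinnertonDyer.Rank1Residual.X11b
open Summit.BirchSwinnertonDyer.BirchSwinnertonDyer.Theses

namespace Summit.BirchSwinnertonDyer.BirchSwinnertonDyer.Theorems

/-- **CRUX 19061 `OpenInputIMC` FROM H3♭, H2, the facts, REST‴ and the ¬(ram) child** — file 4's
`openInputRamOffErratumLocus_of_children_of_rest3` composed with the landed five-child glue
`openInputIMCOfChildren_holds` (item 19284, CLOSED): `IMCDivAtErratumDataAll` (19270) →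
`BDPValueCoreFramesAll` (19275) → `PublishedInputsIMCReduction` (19283) →
`WuthrichShaDividesAnalyticSha` (19285, Wuthrich 2014 Prop. 21, PUBLISHED) →
`thm331_anticyclotomicControl_mult` (JSW17, PUBLISHED) → REST‴ → `OpenInputNotRam` (19282) →
`OpenInputIMC`, where REST‴ := `∀ W p, Ram W p → ¬ ((∃ q prime, q ≠ 2 ∧ q ≠ p ∧ Mult W q ∧ ¬Split W q
∧ p ∤ v_q(Δ_min)) ∧ (∀ P ∈ E(ℚ_p), p • P = 0 → P = 0)) → P2OpenInputOnTreeAt W p`. CONDITIONAL on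
the sibling items and the named facts; nothing booked; no pair closed.
[cite: Castella2018Erratum, Thm. 1.1 (i)–(iv), (2.4) (pp. 1, 4)] [cite: Wuthrich2014, Prop. 21 (p. 400)]
[cite: JetchevSkinnerWan2017, Thm. 3.3.1 with §3.5 (3.5.c) (arXiv:1512.06894 pp. 11, 15)]
[cite: Castella2018, Thms. 3.1–3.2 (p. 9), §5 (p. 12) (arXiv:1704.06608)] [cite: Miller2011LMS, Def. 1.1] -/
theorem openInputIMC_of_children_of_rest3_of_notRam
    (h3 : ErratumRoadFive.IMCDivAtErratumDataAll) (h2 : ErratumRoadFive.BDPValueCoreFramesAll)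
    (hF : ErratumRoadFive.PublishedInputsIMCReduction)
    (hWu : ErratumRoadFive.WuthrichShaDividesAnalyticSha) (h331 : thm331_anticyclotomicControl_mult)
    (hrest : ∀ (W : WeierstrassCurve ℚ) [W.IsElliptic] [W.IsGloballyMinimal] (p : ℕ) [Fact p.Prime],
      Ram W p →
      ¬ ((∃ (q : ℕ) (_ : Fact q.Prime), q ≠ 2 ∧ q ≠ p ∧ Mult W q ∧
            ¬ W.HasSplitMultiplicativeReductionAtPrime q ∧
            ¬ p ∣ padicValInt q W.minimalDiscriminantInt) ∧
          (∀ P : (W.baseChange ℚ_[p]).toAffine.Point, p • P = 0 → P = 0)) →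
      P2OpenInputOnTreeAt W p)
    (hOff : ErratumRoadFive.OpenInputNotRam) : ErratumRoadFive.OpenInputIMC := by
  have hglue := openInputIMCOfChildren_holds
  unfold ErratumRoadFive.OpenInputIMCOfChildren at hglue
  unfold ErratumRoadFive.WuthrichShaDividesAnalyticSha at hWu
  exact hglue h3 (openInputRamOffErratumLocus_of_children_of_rest3 h3 h2 hF hWu h331 hrest) h2 hOff hF

/-- **The same with REST‴ split into the planner's atoms**: H3♭-all, H2-all, facts, Wuthrich, JSW
control, (α) the (ram) pairs with NO odd non-split `E[p]`-ramified multiplicative `q ≠ p`, (β) the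
(ram) pairs with `p` split, `p ∣ v_p(Δ_min)`, `p ∣ c_p` and a non-zero `p`-torsion point in `E(ℚ_p)`,
and the ¬(ram) child ⟹ `OpenInputIMC` (file 4's `rest3_of_noOddWitness_of_localTorsionNeZero`).
Bookkeeping; CONDITIONAL; nothing booked. [cite: Castella2018Erratum, Thm. 1.1 (iii)–(iv) (p. 1)]
[cite: SilvermanATAEC1994, Cor. IV.9.2(d) with (b) (PDF p. 340)] -/
theorem openInputIMC_of_children_of_atoms_of_notRam
    (h3 : ErratumRoadFive.IMCDivAtErratumDataAll) (h2 : ErratumRoadFive.BDPValueCoreFramesAll)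
    (hF : ErratumRoadFive.PublishedInputsIMCReduction)
    (hWu : ErratumRoadFive.WuthrichShaDividesAnalyticSha) (h331 : thm331_anticyclotomicControl_mult)
    (hα : ∀ (W : WeierstrassCurve ℚ) [W.IsElliptic] [W.IsGloballyMinimal] (p : ℕ) [Fact p.Prime],
      Ram W p →
      (∀ (q : ℕ) [Fact q.Prime], q ≠ 2 → q ≠ p → Mult W q →
        ¬ W.HasSplitMultiplicativeReductionAtPrime q → p ∣ padicValInt q W.minimalDiscriminantInt) →
      P2OpenInputOnTreeAt W p)
    (hβ : ∀ (W : WeierstrassCurve ℚ) [W.IsElliptic] [W.IsGloballyMinimal] (p : ℕ) [Fact p.Prime],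
      Ram W p → W.HasSplitMultiplicativeReductionAtPrime p →
      p ∣ padicValInt p W.minimalDiscriminantInt →
      p ∣ (W.baseChange ℚ_[p]).localTamagawaNumber ℤ_[p] →
      (∃ P : (W.baseChange ℚ_[p]).toAffine.Point, p • P = 0 ∧ P ≠ 0) → P2OpenInputOnTreeAt W p)
    (hOff : ErratumRoadFive.OpenInputNotRam) : ErratumRoadFive.OpenInputIMC :=
  openInputIMC_of_children_of_rest3_of_notRam h3 h2 hF hWu h331
    (rest3_of_noOddWitness_of_localTorsionNeZero hα hβ) hOff

/-- **With H3♭ BY CITATION from the OPEN erratum fact** (Castella erratum Thm. 1.1 = arXiv:2409.01360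
Thm. 3.1, `_OPEN`, p417695; bridge `imcDivAtErratumDataAll_of_erratumThm11_OPEN`): the crux ⟸ the
OPEN fact + H2-all (19275) + facts (19283, 19285) + JSW control + (α) + (β) + ¬(ram) (19282). The
kernel form of this seat's row for the WHOLE crux. CONDITIONAL; nothing booked; no pair closed.
[claim: Castella2018Erratum, status: under-review] [cite: Wuthrich2014, Prop. 21 (p. 400)]
[cite: JetchevSkinnerWan2017, Thm. 3.3.1 with §3.5 (3.5.c) (arXiv:1512.06894 pp. 11, 15)] -/
theorem openInputIMC_of_erratumThm11_OPEN_of_bdpValueCoreFrames_of_atoms_of_notRam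
    (h11 : erratumThm11_exists_isBDPLFunction_isTorsion_charIdeal_eq_OPEN)
    (h2 : ErratumRoadFive.BDPValueCoreFramesAll) (hF : ErratumRoadFive.PublishedInputsIMCReduction)
    (hWu : ErratumRoadFive.WuthrichShaDividesAnalyticSha) (h331 : thm331_anticyclotomicControl_mult)
    (hα : ∀ (W : WeierstrassCurve ℚ) [W.IsElliptic] [W.IsGloballyMinimal] (p : ℕ) [Fact p.Prime],
      Ram W p →
      (∀ (q : ℕ) [Fact q.Prime], q ≠ 2 → q ≠ p → Mult W q →
        ¬ W.HasSplitMultiplicativeReductionAtPrime q → p ∣ padicValInt q W.minimalDiscriminantInt) →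
      P2OpenInputOnTreeAt W p)
    (hβ : ∀ (W : WeierstrassCurve ℚ) [W.IsElliptic] [W.IsGloballyMinimal] (p : ℕ) [Fact p.Prime],
      Ram W p → W.HasSplitMultiplicativeReductionAtPrime p →
      p ∣ padicValInt p W.minimalDiscriminantInt →
      p ∣ (W.baseChange ℚ_[p]).localTamagawaNumber ℤ_[p] →
      (∃ P : (W.baseChange ℚ_[p]).toAffine.Point, p • P = 0 ∧ P ≠ 0) → P2OpenInputOnTreeAt W p)
    (hOff : ErratumRoadFive.OpenInputNotRam) : ErratumRoadFive.OpenInputIMC :=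
  openInputIMC_of_children_of_atoms_of_notRam (imcDivAtErratumDataAll_of_erratumThm11_OPEN h11) h2 hF
    hWu h331 hα hβ hOff

/-! ### §2 REST‴ is EXACT: its complement in (ram) is precisely where the erratum's Thm. 1.1 (with
Cas20's odd `d_K`) has an admissible field -/

section Exact

open Literature.NumberTheory.EllipticCurves.ModularForms

variable (W : WeierstrassCurve ℚ) [W.IsElliptic] [W.IsGloballyMinimal] (p : ℕ) [Fact p.Prime]

/-- **The erratum's hypotheses FORCE an odd non-split (ram) witness and (iv).** If some imaginary
quadratic `K` satisfies the hypotheses of Castella's erratum Thm. 1.1 at `(E, p)` VERBATIM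
(`Thm11Hypotheses W p K`: `𝒪_K/𝔑 ≃ ℤ/N` as `d_K ≡ β² (mod 4N)`, `p` split, (i)–(iv)) and has ODD
discriminant ([Cas20, §2.5]'s standing hypothesis, `Cas20Standing`), then `(E, p)` has an ODD non-split
multiplicative `q ≠ p` with `p ∤ v_q(Δ_min)` and `E(ℚ_p)[p] = 0` — i.e. the pair is OUTSIDE REST‴'s
locus. Proof: (iii) gives a multiplicative `ℓ` non-split in `K` with `E[p]` ramified, non-split
multiplicative by (iii); `ℓ ≠ p` since `p` splits; `ℓ ≠ 2` since `2 ∣ N` and `d_K ≡ β² (mod 4N)` with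
`d_K` odd give `d_K ≡ 1 (mod 8)`, so `2` splits (`Quadratic.ncard_primesOver_two_eq_two_iff`). So the
atoms (α), (β) of REST‴ are exactly the (ram) pairs at which the typed erratum fact CANNOT be
instantiated with an odd-`d_K` field. Bookkeeping; nothing asserted about any curve.
[cite: Castella2018Erratum, Thm. 1.1 (p. 1), hypotheses (ii)–(iv)]
[cite: Castella2020JIMJ, §2.5 (author PDF p. 8), "odd discriminant"] -/
theorem oddNonsplitWitness_and_localTorsion_of_thm11Hypotheses_of_odd_discr
    {K : Type} [Field K] [NumberField K] (h11 : Thm11Hypotheses W p K)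
    (hodd : Odd (NumberField.discr K)) :
    (∃ (q : ℕ) (_ : Fact q.Prime), q ≠ 2 ∧ q ≠ p ∧ Mult W q ∧
        ¬ W.HasSplitMultiplicativeReductionAtPrime q ∧ ¬ p ∣ padicValInt q W.minimalDiscriminantInt) ∧
      (∀ P : (W.baseChange ℚ_[p]).toAffine.Point, p • P = 0 → P = 0) := by
  obtain ⟨-, -, hKiq, ⟨β, hβ⟩, hsp, -, -, hns, ⟨ℓ, hℓ, hmℓ, hnℓ, hvℓ⟩, hiv⟩ := h11
  refine ⟨⟨ℓ, hℓ, ?_, ?_, hmℓ, hns ℓ hmℓ hnℓ, hvℓ⟩, hiv⟩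
  · -- `ℓ ≠ 2`: otherwise `2 ∣ N`, `8 ∣ β² − d_K`, `d_K` odd ⟹ `d_K ≡ 1 (mod 8)` ⟹ `2` splits
    rintro rfl
    apply hnℓ
    have h2N : 2 ∣ W.conductorNorm ℤ := dvd_conductorNorm_of_mult hmℓ
    have h8 : (8 : ℤ) ∣ β ^ 2 - NumberField.discr K := by
      obtain ⟨k, hk⟩ := h2N
      refine dvd_trans ⟨(k : ℤ), ?_⟩ hβ
      rw [hk]; push_cast; ring
    have hd : NumberField.discr K % 8 = 1 := by
      obtain ⟨c, hc⟩ := h8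
      obtain ⟨m, hm⟩ := hodd
      rcases Int.even_or_odd β with ⟨t, ht⟩ | ⟨t, ht⟩
      · exfalso
        have hsq : β ^ 2 = 4 * (t * t) := by rw [ht]; ring
        omega
      · have hsq : β ^ 2 = 4 * (t * (t + 1)) + 1 := by rw [ht]; ring
        obtain ⟨j, hj⟩ := Int.even_mul_succ_self t
        omega
    exact (Literature.NumberTheory.QuadraticFields.Quadratic.ncard_primesOver_two_eq_two_iff
      hKiq.1).mpr hd
  · -- `ℓ ≠ p`: `p` splits, `ℓ` does not
    rintro rfl
    exact hnℓ hsp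

/-- **Conversely, on REST‴'s complement an admissible erratum field EXISTS** (modulo modularity and
Friedberg–Hoffstein's ramified non-vanishing): for `(E, p)` in class X11b with `p ≥ 5`, an ODD
non-split multiplicative `q ≠ p` with `p ∤ v_q(Δ_min)` and (iv) `E(ℚ_p)[p] = 0`, there is an
imaginary quadratic `K` which is an erratum field for `q` (`IsErratumField`: `q ∣ d_K`, every other
`ℓ ∣ N` split, `2` split if `2 ∤ N`, `L(E^{d_K},1) ≠ 0`), satisfies the erratum's Thm. 1.1
hypotheses VERBATIM (`Thm11Hypotheses W p K`; the level structure `d_K ≡ β² (mod 4N)` by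
`Quadratic.exists_dvd_sq_sub_discr_of_split_or_dvd`: split primes, and `q` ramified with `q² ∤ N`),
and [Cas20, §2.5]'s standing hypotheses at the tame level (`Cas20Standing K p (N/p)`; odd `d_K`).
Field supply: `erratumField_supply` (root number `−1` from `r_an = 1` and modularity; Friedberg–
Hoffstein). Together with the previous theorem: REST‴ ∩ X11b = EXACTLY the (ram) pairs with no
odd-`d_K` erratum datum. CONDITIONAL on `hnf`, `hFH`; nothing booked.
[cite: Castella2018Erratum, Thm. 1.1 (p. 1)] [cite: Castella2018, §5 (arXiv:1704.06608 p. 12), choice of K]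
[cite: FriedbergHoffstein1995, Thm. B] [cite: Castella2020JIMJ, §2.5 (author PDF p. 8)] -/
theorem exists_erratumField_thm11Hypotheses_of_oddNonsplitWitness_of_localTorsion
    (hnf : exists_isNewformOf) (hFH : friedbergHoffstein_exists_twist_ne_zero_ramifiedAt)
    (hX : ClassX11b W p) (hp5 : 5 ≤ p)
    {q : ℕ} [Fact q.Prime] (hq2 : q ≠ 2) (hqp : q ≠ p) (hmq : Mult W q)
    (hnsq : ¬ W.HasSplitMultiplicativeReductionAtPrime q)
    (hvq : ¬ p ∣ padicValInt q W.minimalDiscriminantInt)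
    (htors : ∀ P : (W.baseChange ℚ_[p]).toAffine.Point, p • P = 0 → P = 0) :
    ∃ (K : Type) (_ : Field K) (_ : NumberField K),
      IsErratumField W K q ∧ Thm11Hypotheses W p K ∧ Cas20Standing K p (W.conductorNorm ℤ / p) := by
  have hE : ErratumHypotheses W p := ⟨hp5, hX.2.2.1, hX.2.2.2, ⟨q, ‹_›, hqp, hmq, hnsq, hvq⟩, htors⟩
  obtain ⟨K, _, _, hKf⟩ := erratumField_supply hnf hFH W p q hX.1 hmq hnsq
  refine ⟨K, ‹_›, ‹_›, hKf, ?_, hKf.cas20Standing hE hqp hq2 hmq⟩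
  have hN0 : W.conductorNorm ℤ ≠ 0 := (W.conductorNorm_pos_holds).ne'
  -- the level structure `d_K ≡ β² (mod 4N)`: every `ℓ ∣ N` splits, except `q`, ramified with `q² ∤ N`
  have hβ : ∃ β : ℤ, (4 * (W.conductorNorm ℤ) : ℤ) ∣ β ^ 2 - NumberField.discr K := by
    refine Literature.NumberTheory.QuadraticFields.Quadratic.exists_dvd_sq_sub_discr_of_split_or_dvd
      hKf.1.1 hN0 fun ℓ hℓ hℓN ↦ ?_
    by_cases hℓq : ℓ = q
    · subst hℓq
      exact Or.inr ⟨hKf.2.1, not_sq_dvd_conductorNorm_of_mult W ℓ hmq⟩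
    · exact Or.inl (hKf.2.2.1 ℓ hℓ hℓN hℓq)
  have hsp : SplitsIn K p := hKf.splitsIn_of_mult hX.2.2.1 (Ne.symm hqp)
  -- `q ∣ d_K` is ramified, hence not split (`(d_K/q) = 0 ≠ 1`)
  have hnq : ¬ SplitsIn K q := by
    intro hs
    have hq : q.Prime := Fact.out
    have hj := (Literature.NumberTheory.QuadraticFields.Quadratic.ncard_primesOver_eq_two_iff_jacobiSym
      hKf.1.1 hq hq2).mp hs
    haveI : NeZero q := ⟨hq.ne_zero⟩
    have h0 : jacobiSym (NumberField.discr K) q = 0 := by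
      rw [jacobiSym.mod_left, Int.emod_eq_zero_of_dvd hKf.2.1, jacobiSym.zero_left hq.one_lt]
    rw [h0] at hj
    exact zero_ne_one hj
  exact thm11Hypotheses_of_isErratumField hE hqp hmq hnsq hvq hKf hβ hsp
    (fun ℓ _ hℓ ↦ dvd_conductorNorm_of_mult hℓ) hnq

end Exact

end Summit.BirchSwinnertonDyer.BirchSwinnertonDyer.Theorems

end
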